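import Summits.FinalStateConjecture.FinalStateConjecture.Theorems.InertialRecession.Negative.CleanScaleCesaro

/-!
# Negative knowledge for the crux `InertialRecession` (item stmt-FinalStateConjecture-10166), V:
ENCOUNTER LEMMAS for the clean-scale toy — confinement costs force, turnaround costs speed

Refuter file (D-0016 negative lane, `--supports stmt-FinalStateConjecture-10166`); companion of
`CleanScaleCesaro.lean` (crossing lemma, `p > 1` ⇒ Cesàro for one relative coordinate; its
first-hitting-time lemma `exists_first_hit` is reused here) and `CleanScaleSharpness.lean`. No Theses
decl is asserted.

The `N ≥ 3` toy of the crux (clean-cluster momentum balance `|Σ_{i∈C} mᵢ ξᵢ''| ≤ K sep(C)^{-p}` at every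
clean scale, all pairwise distances `→ ∞`, bounded speeds ⇒ every `ξᵢ(t)/t` converges) reduces, by the
crossing lemma, to a CLUSTER INDUCTION whose two kinematic ingredients are recorded here:

* `norm_deriv_le_of_confined` (**confinement costs force**, any normed space): if `‖w‖ ≤ D` on
  `[a, a + T]` and `‖w''‖ ≤ A` there, then `‖w'(a)‖ ≤ 2D/T + A T`. Reading: two holes that stay within
  distance `D` of each other for a time `T` while their relative force is `≤ A = K d^{-p}` have relative
  speed `≲ D/T + K d^{-p} T`; optimising, persistent partners (`T → ∞` at fixed `D`-to-`d` ratio) have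
  relative speed `≲ √(K D d^{-p}) → 0` — they share a Cesàro velocity.
* `speed_sq_le_of_turnaround` (**turnaround costs speed**, one dimension): if `r ≥ d > 0`,
  `|r''| ≤ K r^{-p}` (`p > 1`), `r'(t₁) ≤ 0` and `r'(t₂) ≥ 0` for some `t₂ ≥ t₁`, then
  `r'(t₁)² ≤ 2K d^{1-p}/(p - 1)`. Reading: a body approaching a receding pair member at relative speed `u`
  cannot be stopped, let alone sent back, at distance `≥ d → ∞` unless `u² ≲ K d^{1-p} → 0`; this kills
  the "momentum shuttle" (a light hole ferrying `O(1)` momentum between two heavy receding holes would have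
  to be slow relative to BOTH, but `|u - v₁| + |u - v₃| ≥ |v₃ - v₁|`), the only candidate this seat found
  for a toy trajectory with non-convergent `ξᵢ(t)/t` — see `Disproof.lean` §E.
-/

set_option linter.dupNamespace false

noncomputable section

namespace Summit.FinalStateConjecture.FinalStateConjecture.Theorems.InertialRecession.Negative

open Filter Set
open scoped Topology

/-- **Confinement costs force.** In a normed space, if `‖w t‖ ≤ D` and `‖w'' t‖ ≤ A` on `[a, a + T]`
(`T > 0`), then `‖w' a‖ ≤ 2 D / T + A T`. [folklore] -/
theorem norm_deriv_le_of_confined {E : Type*} [NormedAddCommGroup E] [NormedSpace ℝ E]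
    {w w' w'' : ℝ → E} {a T D A : ℝ} (hT : 0 < T)
    (hw : ∀ t ∈ Icc a (a + T), HasDerivAt w (w' t) t)
    (hw' : ∀ t ∈ Icc a (a + T), HasDerivAt w' (w'' t) t)
    (hD : ∀ t ∈ Icc a (a + T), ‖w t‖ ≤ D) (hA : ∀ t ∈ Icc a (a + T), ‖w'' t‖ ≤ A) :
    ‖w' a‖ ≤ 2 * D / T + A * T := by
  have haT : a ≤ a + T := by linarith
  -- first-order control of `w'`: `‖w' t - w' a‖ ≤ A (t - a) ≤ A T`
  have h1 : ∀ t ∈ Icc a (a + T), ‖w' t - w' a‖ ≤ A * T := by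
    intro t ht
    have := norm_image_sub_le_of_norm_deriv_le_segment' (f := w') (f' := w'')
      (fun s hs ↦ (hw' s hs).hasDerivWithinAt) (fun s hs ↦ hA s (Ico_subset_Icc_self hs)) t ht
    refine this.trans ?_
    have hA0 : 0 ≤ A := (norm_nonneg _).trans (hA a (left_mem_Icc.mpr haT))
    exact mul_le_mul_of_nonneg_left (by linarith [ht.2]) hA0
  -- second-order Taylor remainder: `g t = w t - w a - (t - a) • w' a`, `‖g'‖ ≤ A T`
  have h2 : ‖(w (a + T) - w a - ((a + T) - a) • w' a) - (w a - w a - (a - a) • w' a)‖ ≤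
      A * T * ((a + T) - a) := by
    refine norm_image_sub_le_of_norm_deriv_le_segment' (f := fun t ↦ w t - w a - (t - a) • w' a)
      (f' := fun t ↦ w' t - w' a) (fun s hs ↦ ?_) (fun s hs ↦ h1 s (Ico_subset_Icc_self hs)) _
      (right_mem_Icc.mpr haT)
    have hd : HasDerivAt (fun t ↦ w t - w a - (t - a) • w' a) (w' s - 0 - (1 : ℝ) • w' a) s :=
      ((hw s hs).sub (hasDerivAt_const s (w a))).sub (((hasDerivAt_id s).sub_const a).smul_const _)
    simpa using hd.hasDerivWithinAt
  simp only [sub_self, zero_smul, sub_zero, add_sub_cancel_left] at h2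
  -- `T • w' a = (w (a+T) - w a) - g (a+T)`
  have hnorm : ‖T • w' a‖ ≤ 2 * D + A * T * T := by
    have heq : T • w' a = (w (a + T) - w a) - (w (a + T) - w a - T • w' a) := by abel
    rw [heq]
    refine (norm_sub_le _ _).trans ?_
    have hwa : ‖w (a + T) - w a‖ ≤ 2 * D := by
      refine (norm_sub_le _ _).trans ?_
      have := hD (a + T) (right_mem_Icc.mpr haT)
      have := hD a (left_mem_Icc.mpr haT)
      linarith
    linarith
  rw [norm_smul, Real.norm_eq_abs, abs_of_pos hT] at hnorm
  rw [div_add' _ _ _ hT.ne', le_div_iff₀ hT]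
  linarith

/-- **Turnaround costs speed** (one space dimension). If on `[t₁, t₂]` the distance `r` stays `≥ d > 0`,
`|r''| ≤ K r^{-p}` with `p > 1`, the body is approaching at `t₁` (`r'(t₁) ≤ 0`) and no longer
approaching at `t₂` (`r'(t₂) ≥ 0`), then `r'(t₁)² ≤ 2K d^{1-p}/(p-1)`: the quantity
`r'²/2 + K r^{1-p}/(p-1)` is non-decreasing while `r' < 0`. [folklore] -/
theorem speed_sq_le_of_turnaround {r r' r'' : ℝ → ℝ} {t₁ t₂ K p d : ℝ} (ht : t₁ ≤ t₂)
    (hp : 1 < p) (hK : 0 ≤ K) (hd : 0 < d)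
    (hr : ∀ t ∈ Icc t₁ t₂, HasDerivAt r (r' t) t) (hr' : ∀ t ∈ Icc t₁ t₂, HasDerivAt r' (r'' t) t)
    (hbound : ∀ t ∈ Icc t₁ t₂, |r'' t| ≤ K * (r t) ^ (-p)) (hfar : ∀ t ∈ Icc t₁ t₂, d ≤ r t)
    (h₁ : r' t₁ ≤ 0) (h₂ : 0 ≤ r' t₂) :
    (r' t₁) ^ 2 ≤ 2 * K / (p - 1) * d ^ (1 - p) := by
  set c := K / (p - 1) with hc
  have hp1 : 0 < p - 1 := by linarith
  have hc0 : 0 ≤ c := div_nonneg hK hp1.le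
  rcases eq_or_lt_of_le h₁ with h0 | hneg
  · rw [h0]
    simp only [ne_eq, OfNat.ofNat_ne_zero, not_false_eq_true, zero_pow]
    have : 0 ≤ d ^ (1 - p) := Real.rpow_nonneg hd.le _
    positivity
  -- first time `ts ∈ (t₁, t₂]` with `r' ≥ 0`; before it `r' < 0`
  have hcont' : ContinuousOn r' (Icc t₁ t₂) := fun t ht ↦ (hr' t ht).continuousAt.continuousWithinAt
  have hclosed : IsClosed {t | t ∈ Icc t₁ t₂ ∧ 0 ≤ r' t} := by
    have := hcont'.preimage_isClosed_of_isClosed isClosed_Icc (isClosed_Ici (a := (0 : ℝ)))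
    convert this using 1
    ext t
    simp
  obtain ⟨ts, h1s, hs2, hsP, hbefore⟩ := exists_first_hit (P := fun t ↦ 0 ≤ r' t) ht hclosed
    (not_le.mpr hneg) h₂
  have hsub : Icc t₁ ts ⊆ Icc t₁ t₂ := Icc_subset_Icc le_rfl hs2
  -- the energy-like quantity `H t = r'² / 2 + c r^{1-p}` is monotone on `[t₁, ts]`
  have hpos : ∀ t ∈ Icc t₁ t₂, 0 < r t := fun t ht ↦ lt_of_lt_of_le hd (hfar t ht)
  have hH : ∀ t ∈ Icc t₁ t₂, HasDerivAt (fun t ↦ r' t ^ 2 / 2 + c * r t ^ (1 - p))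
      (r' t * r'' t + c * ((1 - p) * r t ^ (1 - p - 1) * r' t)) t := by
    intro t ht
    have hd1 : HasDerivAt (fun t ↦ r' t ^ 2 / 2) (r' t * r'' t) t := by
      have := ((hr' t ht).pow 2).div_const 2
      refine this.congr_deriv ?_
      simp only [Nat.cast_ofNat]
      ring
    have hd2 : HasDerivAt (fun t ↦ c * r t ^ (1 - p)) (c * ((1 - p) * r t ^ (1 - p - 1) * r' t)) t :=
      ((hr t ht).rpow_const (p := 1 - p) (Or.inl (hpos t ht).ne')).const_mul c |>.congr_deriv
        (by ring)
    exact hd1.add hd2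
  have hmono : MonotoneOn (fun t ↦ r' t ^ 2 / 2 + c * r t ^ (1 - p)) (Icc t₁ ts) := by
    refine monotoneOn_of_hasDerivWithinAt_nonneg (convex_Icc t₁ ts)
      (fun t ht ↦ (hH t (hsub ht)).continuousAt.continuousWithinAt)
      (fun t ht ↦ (hH t (hsub (interior_subset ht))).hasDerivWithinAt) ?_
    intro t ht
    rw [interior_Icc] at ht
    have ht' : t ∈ Icc t₁ t₂ := hsub ⟨ht.1.le, ht.2.le⟩
    have hneg_t : r' t < 0 := not_le.mp (hbefore t ⟨ht.1.le, ht.2⟩)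
    have hrt := hpos t ht'
    -- derivative = r' (r'' - K r^{-p}) ≥ 0
    have key : r' t * r'' t + c * ((1 - p) * r t ^ (1 - p - 1) * r' t) =
        r' t * (r'' t - K * r t ^ (-p)) := by
      rw [show (1 - p - 1 : ℝ) = -p by ring, hc]
      field_simp
      ring
    rw [key]
    have hb := hbound t ht'
    have : r'' t - K * r t ^ (-p) ≤ 0 := by linarith [le_abs_self (r'' t)]
    nlinarith
  have hle := hmono (left_mem_Icc.mpr h1s.le) (right_mem_Icc.mpr h1s.le) h1s.le
  simp only at hle
  -- at `ts`: `r' ts = 0` is not needed, only `r'² ≥ 0`; bound the potential terms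
  have hts : ts ∈ Icc t₁ t₂ := ⟨h1s.le, hs2⟩
  have hpow_ts : r ts ^ (1 - p) ≤ d ^ (1 - p) :=
    Real.rpow_le_rpow_of_nonpos hd (hfar ts hts) (by linarith)
  have hpow_t1 : 0 ≤ r t₁ ^ (1 - p) := Real.rpow_nonneg (hpos t₁ (left_mem_Icc.mpr ht)).le _
  -- `r' ts = 0`: it is the first time with `r' ≥ 0`, and `r'` is continuous
  have hrs : r' ts = 0 := by
    refine le_antisymm ?_ hsP
    -- limit from the left of negative values
    have hcts : ContinuousWithinAt r' (Iio ts) ts :=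
      ((hr' ts hts).continuousAt.continuousWithinAt)
    refine le_of_tendsto hcts.tendsto ?_
    filter_upwards [Ico_mem_nhdsLT h1s] with t ht'
    exact (not_le.mp (hbefore t ht')).le
  rw [hrs] at hle
  simp only [ne_eq, OfNat.ofNat_ne_zero, not_false_eq_true, zero_pow, zero_div, zero_add] at hle
  have : r' t₁ ^ 2 / 2 ≤ c * d ^ (1 - p) := by nlinarith [mul_le_mul_of_nonneg_left hpow_ts hc0]
  rw [hc] at this
  have h' : r' t₁ ^ 2 ≤ 2 * (K / (p - 1) * d ^ (1 - p)) := by linarith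
  calc r' t₁ ^ 2 ≤ 2 * (K / (p - 1) * d ^ (1 - p)) := h'
    _ = 2 * K / (p - 1) * d ^ (1 - p) := by ring

/-- The shuttle obstruction in one line: a body with velocity `u` cannot be slow relative to both of two
bodies with velocities `v₁`, `v₃`. [folklore] -/
theorem shuttle_triangle (u v₁ v₃ : ℝ) : |v₃ - v₁| ≤ |u - v₁| + |u - v₃| := by
  have := abs_sub_le v₃ u v₁
  rw [abs_sub_comm v₃ u] at this
  linarith

end Summit.FinalStateConjecture.FinalStateConjecture.Theorems.InertialRecession.Negative

end
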